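import Summits.AtomisticToContinuum.HydrodynamicLimit.Theorems.JParityClosureOddContactSymmetryHardCoreMarginals
import Literature.MathematicalPhysics.KineticTheory.HardSphereUniformGas
import Literature.MathematicalPhysics.KineticTheory.HardSphereEulerProofs
import HarnessLib

/-!
# The insertion bound of the hard-core canonical measure, transported to full configurations
# (`LambertianContactSwap.LambertianEuler`, stmt-AtomisticToContinuum-11854, line `Sketch`; lead c10,
# piece W2 `GibbsInsertionZip`)

The rung-0 (constant-profile) local Gibbs law `G` of `N + 1` hard spheres of diameter
`ε = hsDiameter σ N` on `𝕋³` (activity `b > 0`, temperature `ϑ > 0`, drift `w`) is the image under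
`zipConfig : (Fin (N+1) → 𝕋³) × (Fin (N+1) → ℝ³) → Config (N+1) (Fin 3) 𝕋³` of
`posGibbsMeasure (const b) ε (N+1) ⊗ ⊗ᵢ N(w, ϑ id)` (`localGibbsLaw_eq`,
`localGibbsMeasure_rung0_eq_map`).  The landed insertion bound `posGibbsMeasure_marginal_le` states
that, at reduced density `v₁ σ³ ≤ 1/2` (`σ < 1/2`), an event of POSITIONS depending only on the labels
of a set `I` has `posGibbsMeasure`-probability at most `2^{|I|}` times its Haar measure.

Here this is transported to events `A` of full configurations (positions and velocities) depending
only on the particles labelled by `I`: with the FREE rung-0 law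
`U := ⊗ᵢ (Haar ⊗ N(w, ϑ id))` on `Config (N+1) (Fin 3) 𝕋³`,

  `G A ≤ 2^{|I|} · U A`  (`localGibbsLaw_le_pow_mul_pi`).

Proof: Tonelli with the velocities outside (`Measure.prod_apply_symm`); for each velocity vector `v`
the position section `{x | zipConfig (x, v) ∈ A}` is measurable and depends only on the positions
labelled by `I`, so `posGibbsMeasure_marginal_le` applies; `lintegral_mono`, `lintegral_const_mul`,
Tonelli backwards, and the identification `(⊗ᵢ Haar) ⊗ (⊗ᵢ γ) ∘ zipConfig⁻¹ = ⊗ᵢ (Haar ⊗ γ)`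
(`MeasureTheory.measurePreserving_arrowProdEquivProdArrow`; `zipConfig` is the inverse of
`MeasurableEquiv.arrowProdEquivProdArrow`).

References: Spohn 1991, Part I §2.1–2.3 (canonical hard-sphere measure, local equilibrium);
Pulvirenti–Tsagkarogiannis 2012 §3 (insertion bounds in the canonical ensemble).
-/

noncomputable section

namespace Summit.AtomisticToContinuum.HydrodynamicLimit.Theorems.LambertianContactSwapLambertianEulerGibbsInsertionZip

open scoped BigOperators Topology ENNReal InnerProductSpace
open MeasureTheory ProbabilityTheory Filter Set
open Literature.MathematicalPhysics.KineticTheory Literature.MathematicalPhysics.StatisticalMechanics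
open Literature.Analysis.FluidPDE

/-- **The free rung-0 law pulled back by `zipConfig`**: the preimage under `zipConfig` of an event of
configurations has `(⊗ᵢ Haar) ⊗ (⊗ᵢ N(w, ϑ id))`-measure equal to its `⊗ᵢ (Haar ⊗ N(w, ϑ id))`-measure
(`zipConfig` is the inverse of the measure-preserving `MeasurableEquiv.arrowProdEquivProdArrow`).
[folklore] -/
theorem volume_prod_pi_preimage_zipConfig (w : V3) (ϑ : ℝ) (N : ℕ)
    {A : Set (Config (N + 1) (Fin 3) T3)} (hA : MeasurableSet A) :
    ((volume : Measure (Fin (N + 1) → T3)).prod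
        (Measure.pi fun _ : Fin (N + 1) => gaussMeasure w ϑ))
        ((zipConfig : (Fin (N + 1) → T3) × (Fin (N + 1) → V3) → Config (N + 1) (Fin 3) T3) ⁻¹' A) =
      Measure.pi (fun _ : Fin (N + 1) => (volume : Measure T3).prod (gaussMeasure w ϑ)) A := by
  have hmp := (measurePreserving_arrowProdEquivProdArrow T3 V3 (Fin (N + 1))
    (fun _ => (volume : Measure T3)) (fun _ => gaussMeasure w ϑ)).symm _
  rw [← hmp.measure_preimage hA.nullMeasurableSet]
  rfl

/-- **Insertion bound of the rung-0 local Gibbs law against the free product law.**  For constant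
profiles `b, ϑ > 0`, `w`, reduced diameter `0 < σ < 1/2` at reduced density `v₁ σ³ ≤ 1/2`, every `N`,
every flow `Φ`, every label set `I` and every measurable event `A` of configurations depending only on
the particles labelled by `I`:
`G A ≤ 2^{|I|} · (⊗ᵢ (Haar ⊗ N(w, ϑ id))) A`, where `G` is the local Gibbs law of `N + 1` hard spheres
of diameter `hsDiameter σ N` (Tonelli over the velocities, the position-marginal insertion bound
`posGibbsMeasure_marginal_le` on each velocity section, and the product structure
`localGibbsMeasure_rung0_eq_map` / `measurePreserving_arrowProdEquivProdArrow`). [folklore] -/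
theorem localGibbsLaw_le_pow_mul_pi :
    ∀ (b ϑ : ℝ) (w : V3), 0 < b → 0 < ϑ → ∀ σ : ℝ, 0 < σ → σ < 1 / 2 → v₁ * σ ^ 3 ≤ 1 / 2 →
      ∀ (N : ℕ) (Φ : HardSphereFlow (Torus.geometry (Fin 3)) (hsDiameter σ N) (N + 1))
        (I : Finset (Fin (N + 1))) (A : Set (Config (N + 1) (Fin 3) T3)), MeasurableSet A →
        (∀ y y' : Config (N + 1) (Fin 3) T3, (∀ i ∈ I, y i = y' i) → (y ∈ A ↔ y' ∈ A)) →
        localGibbsLaw σ (fun _ => b) (fun _ => w) (fun _ => ϑ) N Φ A ≤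
          2 ^ I.card * Measure.pi (fun _ : Fin (N + 1) => (volume : Measure T3).prod (gaussMeasure w ϑ)) A := by
  intro b ϑ w hb hϑ σ hσ hσ2 hlam N Φ I A hA hAI
  haveI : IsProbabilityMeasure (posGibbsMeasure (fun _ : T3 => b) (hsDiameter σ N) (N + 1)) :=
    isProbabilityMeasure_posGibbsMeasure continuous_const (fun _ => hb) hσ2.le N
  have hz : MeasurableEmbedding
      (zipConfig : (Fin (N + 1) → T3) × (Fin (N + 1) → V3) → Config (N + 1) (Fin 3) T3) :=
    (MeasurableEquiv.arrowProdEquivProdArrow T3 V3 (Fin (N + 1))).symm.measurableEmbedding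
  have hA' : MeasurableSet
      ((zipConfig : (Fin (N + 1) → T3) × (Fin (N + 1) → V3) → Config (N + 1) (Fin 3) T3) ⁻¹' A) :=
    measurable_zipConfig hA
  -- the insertion bound on each velocity section
  have hsec : ∀ v : Fin (N + 1) → V3,
      posGibbsMeasure (fun _ : T3 => b) (hsDiameter σ N) (N + 1)
          ((fun x => (x, v)) ⁻¹'
            ((zipConfig : (Fin (N + 1) → T3) × (Fin (N + 1) → V3) → Config (N + 1) (Fin 3) T3) ⁻¹' A)) ≤
        2 ^ I.card * volume ((fun x => (x, v)) ⁻¹'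
            ((zipConfig : (Fin (N + 1) → T3) × (Fin (N + 1) → V3) → Config (N + 1) (Fin 3) T3) ⁻¹' A)) := by
    intro v
    refine posGibbsMeasure_marginal_le hb hσ hσ2 hlam N I (measurable_prodMk_right hA') ?_
    intro x x' hxx'
    simp only [mem_preimage]
    refine hAI _ _ fun i hi => ?_
    show (x i, v i) = (x' i, v i)
    rw [hxx' i hi]
  rw [localGibbsLaw_eq, localGibbsMeasure_rung0_eq_map σ hb.le hϑ w N, hz.map_apply,
    Measure.prod_apply_symm hA']
  calc ∫⁻ v, posGibbsMeasure (fun _ : T3 => b) (hsDiameter σ N) (N + 1)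
          ((fun x => (x, v)) ⁻¹'
            ((zipConfig : (Fin (N + 1) → T3) × (Fin (N + 1) → V3) → Config (N + 1) (Fin 3) T3) ⁻¹' A))
          ∂(Measure.pi fun _ : Fin (N + 1) => gaussMeasure w ϑ)
      ≤ ∫⁻ v, 2 ^ I.card * volume ((fun x => (x, v)) ⁻¹'
            ((zipConfig : (Fin (N + 1) → T3) × (Fin (N + 1) → V3) → Config (N + 1) (Fin 3) T3) ⁻¹' A))
          ∂(Measure.pi fun _ : Fin (N + 1) => gaussMeasure w ϑ) :=
        lintegral_mono hsec
    _ = 2 ^ I.card * ((volume : Measure (Fin (N + 1) → T3)).prod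
          (Measure.pi fun _ : Fin (N + 1) => gaussMeasure w ϑ))
          ((zipConfig : (Fin (N + 1) → T3) × (Fin (N + 1) → V3) → Config (N + 1) (Fin 3) T3) ⁻¹' A) := by
        rw [lintegral_const_mul _ (measurable_measure_prodMk_right hA'), Measure.prod_apply_symm hA']
    _ = 2 ^ I.card *
          Measure.pi (fun _ : Fin (N + 1) => (volume : Measure T3).prod (gaussMeasure w ϑ)) A := by
        rw [volume_prod_pi_preimage_zipConfig w ϑ N hA]

end Summit.AtomisticToContinuum.HydrodynamicLimit.Theorems.LambertianContactSwapLambertianEulerGibbsInsertionZip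

end
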